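import Mathlib
import Literature.MathematicalPhysics.QuantumFieldTheory.MagnenRivasseauSeneor1993.MRS93BosonFirstOrderVI17
import Literature.MathematicalPhysics.QuantumFieldTheory.MagnenRivasseauSeneor1993.MRS93HomotheticCovariantA27
import HarnessLib

/-!
# Magnen–Rivasseau–Sénéor, *Construction of YM₄ with an infrared cutoff* (CMP 155, 1993), §VI: the determinant «1 + βP» of the
# twelve by twelve matrix BF (VI.9) at the homothetic gauge — a closed form on an explicit one-parameter family, kernel-checked:
# with (VI.9) read literally, `det BF` CHANGES SIGN at large background whenever `ζ < 1/2` (e.g. `ζ = 3/13`); with the cross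
# ordering of p.357/(A.27) it stays POSITIVE (v1.1)

statement-level skeleton of published theorems with citation tags; proofs where landed; nothing here is a claim about the
Yang–Mills mass gap, about continuum YM₄ on T⁴, or about the Clay problem

**Citation header (reproduction of PUBLISHED work).** J. Magnen, V. Rivasseau, R. Sénéor, *Construction of YM₄ with an infrared
cutoff*, Commun. Math. Phys. **155** (1993) 325–383 [MagnenRivasseauSeneor1993], §VI (VI.2), (VI.6) p.369, (VI.9) p.370, (VI.14) p.372,
Lemma VI.2 (VI.20a/b) p.374; App. 1 (A.27) p.382 and p.383 tl.1–7. Cell pub-balaban-gaps (YM blitz, track G3), seat mrs-lit-2 (gen 4; docfix v1.2 gen 5);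
companion record `run/shared/lean/pub/pub-balaban-gaps/g3/MRS-AS-PRINTED-estimates.md` §3 finding (l); companions
`MRS93HomotheticCovariantA27.lean` (imported in v1.1 for `HomotheticA27.BFm1Cross`; (A.27): the covariant bound holds for the cross form,
fails for the ordering the displays print) and
`MRS93BosonFirstOrderVI17.lean` (imported: the blocks `BosonTrace.BFm1 ζ w ψ x y n₀ n₁ n₂ n₃ μ ν` of `BF − 1`, (VI.9) first line read
literally on the unit momentum sphere, with (VI.6) `Pmat`, (VI.8) `PsqUnit`, (VI.7) `KFPUnit`). Exact-arithmetic companion: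
`run/shared/lean/pub/pub-balaban-gaps/pub-balaban-gaps-mrs-lit-2/g4/a27_check.py` (168 rational points; this file proves its headline value
`−50311328125/3` in the kernel).

**What the paper prints.** (VI.9) p.370: «BF = δ_μν + ψ[(P²δ_μσ − (1 − ζ)P_μP_σ)(δ_σν + (ζ⁻¹ − 1)p_σp_ν/p²) − p²δ_μν]»; p.372 [PDF 48]
tl.8: «Remark that all these matrices are homogeneous.»; tl.15–17: «We put v = p²/x² = uM²ⁱ/x², β = κ_k(u)/v = x²M⁻²ⁱκ_k(u)/u (β is a
function of k, u and x), κ = κ_k(u) and y = tx, t ∈ [0, 1].»; tl.18–20: «With these notations we can compute explicitly the three by three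
determinant (VI.13) and in principle the twelve by twelve determinant (VI.9) and we find …» (VI.14); tl.33–34: «where P is a polynomial
in all the variables listed, whose explicit computation requires the evaluation of the twelve by twelve determinant (VI.9).» (page images
`run/shared/lean/pub/pub-balaban-gaps/pub-balaban-gaps-mrs-lit-2/g5/renders/p48_crop_r300-2100_s2.png`, `p48_crop_r2000-2700_s2.png`,
`p48_crop_r4000-5000_s2.png`. Docfix v1.2, referee gen 11 FINDING F-P372: v1/v1.1 quoted here «p.372 tl.6–8: ‹It is a polynomial of
degree 24 in β^{1/2}x⁻¹ … variables x and y = tx›», a sentence that is NOT PRINTED — «degree 24» was the seat's own count, 12 × (degree 2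
in (x, y)), for det BF read literally; the paper prints only the sentences above. No Lean statement changed.) (VI.14) p.372 and
Lemma VI.2 p.374 integrate «− (1/2) ln(1 + βP(β, κ, t, cos θ, sin φ, ζ, 1/ζ))», `1 + βP = det BF`; p.383 tl.5–7: «this proves that the determinant of
(−Δ_B^{homothetic})(−Δ^{homothetic})⁻¹ is bounded away from 0 up to a constant factor by the bound (A.6)»; p.339 tl.34: «ζ is the number close
to 3/13 defining the homothetic gauge».

**What this file PROVES (kernel; zero `sorry`, zero named facts; numbers, not adjectives).** On the explicit family
  momentum `p = (1, 0, 0, 0)` (`|p| = 1`; in the angles of p.372: `θ = φ = π/2`), cutoff value `κ = ψ = 1`, background `x = y = s` (`t = 1`,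
  `β = κx² = s²`), gauge parameter `ζ` with `w` standing for `ζ⁻¹`,
the 12 × 12 matrix `BF` assembled from the printed blocks (`BF12`, `BFe0`) is — after the coordinate permutation `blockEquiv` — BLOCK DIAGONAL
with blocks of sizes 3, 2, 2 and five 1's (`BFe0_reindex`), whence the CLOSED FORM
  **`det_BFe0`**: `det BF = w³ (1 + s²)⁵ (1 + 2s²) (ζ + 3ζs² + (1 + ζ)s⁴)² (ζ + 3ζs² − 2(1 − 2ζ)s⁴)`.
Consequences: `det_BFe0_neg` — for `0 < ζ < 1/2`, `w > 0` and `ζ(1 + 3s²) < 2(1 − 2ζ)s⁴` (every large `s`) the determinant is NEGATIVE;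
`det_BFe0_homothetic` — at `ζ = 3/13`, `w = 13/3`, `s = 2`: `det BF = −50311328125/3` (the exact-arithmetic value of record); `det_BFe0_pos`
— for every `ζ ≥ 1/2` and `w > 0` it is positive on the whole family; `det_BFe0_zero_inv` — at `s = 0`, `w = ζ⁻¹` it is `1` (p.368 normalisation). So, with (VI.9) read literally, the
argument «1 + βP» of the logarithm in (VI.14)/Lemma VI.2 is negative at large `β` in this momentum direction for every `ζ < 1/2`, in particular
at the homothetic `ζ = 3/13`; the threshold `1/2` is the one found for the quadratic form in `MRS93HomotheticCovariantA27.lean`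
(`formDiv_family_neg`).
* §2 (v1.1) the same family for the CROSS-ordered operator (`HomotheticA27.BFm1Cross`, the form p.357 tl.10 and (A.27) describe):
  block form `3 ⊕ 2 ⊕ 2 ⊕ 2 ⊕ 1³` (`BFe0Cross_reindex`) and **`det_BFe0Cross`**:
  `det BF_cross = w³ζ(1 + ζs²)(1 + (4 − ζ)s² + 2s⁴)(ζ + 3ζs² + (1 + ζ)s⁴)²((1 + s²)² − (1 − ζ)²s⁴)(1 + s²)²(1 + 2s²)`, **POSITIVE for every
  `s` when `0 < ζ ≤ 1`, `w > 0`** (`det_BFe0Cross_pos`); at the homothetic point `det_BFe0Cross_homothetic = 89234619140625/28561` (the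
  script's «det BF_Mt», kernel-confirmed) against `−50311328125/3` for the literal ordering.

**What is NOT claimed.** Other momentum directions or `κ < 1` (exact arithmetic only, record §3(l): literal ordering negative at 113/168
sampled rational points, cross ordering positive at 168/168); which ordering of the `(1 − ζ)`-blocks the authors intend; Lemma VI.1/VI.2 in
either direction. Nothing here bears on Bałaban's papers; nothing is continuum YM₄ on T⁴, nothing lifts the
infrared cutoff, nothing is Clay.
-/

noncomputable section

namespace Literature.MathematicalPhysics.QuantumFieldTheory.MagnenRivasseauSeneor1993

namespace DetSign

open Complex Matrix BosonTrace FeynmanGauge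

/-- The 12 × 12 matrix `BF` of (VI.9) (first line, unit momentum sphere), indexed by `(μ, a)`, `μ ∈ Fin 4` (space-time), `a ∈ Fin 3`
(colour): `BF = 1 + (BF − 1)` with the blocks `BosonTrace.BFm1`. [cite: MagnenRivasseauSeneor1993, §VI (VI.9) p.370] -/
def BF12 (ζ w ψ x y n₀ n₁ n₂ n₃ : ℝ) : Matrix (Fin 4 × Fin 3) (Fin 4 × Fin 3) ℂ :=
  Matrix.of fun i j => (if i = j then (1 : ℂ) else 0) + BFm1 ζ w ψ x y n₀ n₁ n₂ n₃ i.1 j.1 i.2 j.2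

/-- The explicit family: `p = (1,0,0,0)`, `ψ = κ = 1`, `x = y = s`. [cite: MagnenRivasseauSeneor1993, §VI (VI.9) p.370, p.372 tl.8–17] -/
def BFe0 (ζ w s : ℝ) : Matrix (Fin 4 × Fin 3) (Fin 4 × Fin 3) ℂ := BF12 ζ w 1 s s 1 0 0 0

/-- Block index type: a 3-block, a 2-block, a 2-block and five 1-blocks. [cite: MagnenRivasseauSeneor1993, §VI (VI.9) p.370] -/
abbrev BlockIdx := (Fin 3 ⊕ Fin 2) ⊕ (Fin 2 ⊕ Fin 5)

/-- Coordinates → blocks: `{(0,2),(1,1),(2,0)}`, `{(0,1),(1,2)}`, `{(0,0),(2,2)}`, `{(1,0)},{(2,1)},{(3,0)},{(3,1)},{(3,2)}` (0-indexed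
colour; in the paper's 1-indexed colours the 3-block is `{e_{0,3}, e_{1,2}, e_{2,1}}`). [cite: MagnenRivasseauSeneor1993, §VI (VI.9) p.370] -/
def toBlock (i : Fin 4 × Fin 3) : BlockIdx :=
  (![![Sum.inr (Sum.inl 0), Sum.inl (Sum.inr 0), Sum.inl (Sum.inl 0)],
     ![Sum.inr (Sum.inr 0), Sum.inl (Sum.inl 1), Sum.inl (Sum.inr 1)],
     ![Sum.inl (Sum.inl 2), Sum.inr (Sum.inr 1), Sum.inr (Sum.inl 1)],
     ![Sum.inr (Sum.inr 2), Sum.inr (Sum.inr 3), Sum.inr (Sum.inr 4)]] : Fin 4 → Fin 3 → BlockIdx) i.1 i.2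

/-- Blocks → coordinates. [cite: MagnenRivasseauSeneor1993, §VI (VI.9) p.370] -/
def fromBlock : BlockIdx → Fin 4 × Fin 3 :=
  Sum.elim (Sum.elim ![(0, 2), (1, 1), (2, 0)] ![(0, 1), (1, 2)])
    (Sum.elim ![(0, 0), (2, 2)] ![(1, 0), (2, 1), (3, 0), (3, 1), (3, 2)])

/-- The coordinate permutation as an equivalence. [cite: MagnenRivasseauSeneor1993, §VI (VI.9) p.370] -/
def blockEquiv : (Fin 4 × Fin 3) ≃ BlockIdx where
  toFun := toBlock
  invFun := fromBlock
  left_inv := by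
    intro i
    obtain ⟨μ, a⟩ := i
    fin_cases μ <;> fin_cases a <;> rfl
  right_inv := by
    intro k
    rcases k with ((k | k) | (k | k)) <;> fin_cases k <;> rfl

/-- The 3 × 3 block on `{e_{0,3}, e_{1,2}, e_{2,1}}` (paper's colours): `(w(ζ + 2s²), −i(1−ζ)s, i(1−ζ)s; i(1−ζ)ws, 1 + ζs², (1−ζ)s²;
−i(1−ζ)ws, (1−ζ)s², 1 + ζs²)`. [cite: MagnenRivasseauSeneor1993, §VI (VI.6), (VI.9) pp.369–370] -/
def H3 (ζ w s : ℝ) : Matrix (Fin 3) (Fin 3) ℂ :=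
  !![(w * (ζ + 2 * s ^ 2) : ℝ), -(I * ((1 - ζ) * s : ℝ)), I * ((1 - ζ) * s : ℝ);
    I * ((1 - ζ) * w * s : ℝ), ((1 + ζ * s ^ 2 : ℝ) : ℂ), (((1 - ζ) * s ^ 2 : ℝ) : ℂ);
    -(I * ((1 - ζ) * w * s : ℝ)), (((1 - ζ) * s ^ 2 : ℝ) : ℂ), ((1 + ζ * s ^ 2 : ℝ) : ℂ)]

/-- The 2 × 2 block on `{e_{0,2}, e_{1,3}}`: `(w(ζ + s²), i(1−ζ)s; −i(1−ζ)ws, 1 + s² + ζs²)`. [cite: MagnenRivasseauSeneor1993, §VI (VI.6), (VI.9) pp.369–370] -/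
def K2 (ζ w s : ℝ) : Matrix (Fin 2) (Fin 2) ℂ :=
  !![(w * (ζ + s ^ 2) : ℝ), I * ((1 - ζ) * s : ℝ); -(I * ((1 - ζ) * w * s : ℝ)), ((1 + s ^ 2 + ζ * s ^ 2 : ℝ) : ℂ)]

/-- The 2 × 2 block on `{e_{0,1}, e_{2,3}}`: `(w(ζ + s²), −i(1−ζ)s; i(1−ζ)ws, 1 + s² + ζs²)`. [cite: MagnenRivasseauSeneor1993, §VI (VI.6), (VI.9) pp.369–370] -/
def K2' (ζ w s : ℝ) : Matrix (Fin 2) (Fin 2) ℂ :=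
  !![(w * (ζ + s ^ 2) : ℝ), -(I * ((1 - ζ) * s : ℝ)); I * ((1 - ζ) * w * s : ℝ), ((1 + s ^ 2 + ζ * s ^ 2 : ℝ) : ℂ)]

/-- The five decoupled coordinates `e_{1,1}, e_{2,2}, e_{3,1}, e_{3,2}, e_{3,3}`: diagonal `(1+s², 1+s², 1+s², 1+s², 1+2s²)`.
[cite: MagnenRivasseauSeneor1993, §VI (VI.8), (VI.9) p.370] -/
def D5 (s : ℝ) : Matrix (Fin 5) (Fin 5) ℂ :=
  Matrix.diagonal ![((1 + s ^ 2 : ℝ) : ℂ), ((1 + s ^ 2 : ℝ) : ℂ), ((1 + s ^ 2 : ℝ) : ℂ), ((1 + s ^ 2 : ℝ) : ℂ), ((1 + 2 * s ^ 2 : ℝ) : ℂ)]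

/-- The block-diagonal normal form. [cite: MagnenRivasseauSeneor1993, §VI (VI.9) p.370] -/
def Nblocks (ζ w s : ℝ) : Matrix BlockIdx BlockIdx ℂ :=
  Matrix.fromBlocks (Matrix.fromBlocks (H3 ζ w s) 0 0 (K2 ζ w s)) 0 0 (Matrix.fromBlocks (K2' ζ w s) 0 0 (D5 s))

set_option maxHeartbeats 1600000 in
/-- **`BF` on the family is block diagonal**: permuting coordinates by `blockEquiv` turns `BFe0 ζ w s` into `Nblocks ζ w s` (all 144
entries checked against the printed blocks (VI.6)/(VI.9)). [cite: MagnenRivasseauSeneor1993, §VI (VI.6), (VI.9) pp.369–370] -/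
theorem BFe0_reindex (ζ w s : ℝ) : Matrix.reindex blockEquiv blockEquiv (BFe0 ζ w s) = Nblocks ζ w s := by
  ext k l
  rcases k with ((k | k) | (k | k)) <;> rcases l with ((l | l) | (l | l)) <;> fin_cases k <;> fin_cases l <;>
    simp [Nblocks, BFe0, BF12, BFm1, blockEquiv, fromBlock, H3, K2, K2', D5, PsqUnit, KFPUnit, Pmat, nvec,
      Matrix.fromBlocks, Matrix.diagonal, Matrix.of_apply] <;>
    ring_nf <;> (try simp only [Complex.I_sq]) <;> (try ring_nf)

/-- `det H3 = w(1 + s²)(ζ + 3ζs² − 2(1 − 2ζ)s⁴)`. [cite: MagnenRivasseauSeneor1993, §VI (VI.9) p.370] -/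
theorem det_H3 (ζ w s : ℝ) :
    (H3 ζ w s).det = ((w * (1 + s ^ 2) * (ζ + 3 * ζ * s ^ 2 - 2 * (1 - 2 * ζ) * s ^ 4) : ℝ) : ℂ) := by
  rw [H3, Matrix.det_fin_three]
  simp
  ring_nf
  simp only [Complex.I_sq]
  ring

/-- `det K2 = w(ζ + 3ζs² + (1 + ζ)s⁴)`. [cite: MagnenRivasseauSeneor1993, §VI (VI.9) p.370] -/
theorem det_K2 (ζ w s : ℝ) : (K2 ζ w s).det = ((w * (ζ + 3 * ζ * s ^ 2 + (1 + ζ) * s ^ 4) : ℝ) : ℂ) := by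
  rw [K2, Matrix.det_fin_two]
  simp
  ring_nf
  simp only [Complex.I_sq]
  ring

/-- `det K2' = w(ζ + 3ζs² + (1 + ζ)s⁴)`. [cite: MagnenRivasseauSeneor1993, §VI (VI.9) p.370] -/
theorem det_K2' (ζ w s : ℝ) : (K2' ζ w s).det = ((w * (ζ + 3 * ζ * s ^ 2 + (1 + ζ) * s ^ 4) : ℝ) : ℂ) := by
  rw [K2', Matrix.det_fin_two]
  simp
  ring_nf
  simp only [Complex.I_sq]
  ring

/-- `det D5 = (1 + s²)⁴(1 + 2s²)`. [cite: MagnenRivasseauSeneor1993, §VI (VI.8) p.370] -/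
theorem det_D5 (s : ℝ) : (D5 s).det = (((1 + s ^ 2) ^ 4 * (1 + 2 * s ^ 2) : ℝ) : ℂ) := by
  rw [D5, Matrix.det_diagonal, Fin.prod_univ_five]
  simp only [Matrix.cons_val]
  push_cast
  ring

/-- **The closed form.** On the family `p = (1,0,0,0)`, `κ = 1`, `x = y = s`:
`det BF = w³ (1 + s²)⁵ (1 + 2s²) (ζ + 3ζs² + (1 + ζ)s⁴)² (ζ + 3ζs² − 2(1 − 2ζ)s⁴)` (`w` standing for `ζ⁻¹`; the identity is polynomial
and holds for all real `ζ, w, s`). [cite: MagnenRivasseauSeneor1993, §VI (VI.9), (VI.14) pp.370–372] -/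
theorem det_BFe0 (ζ w s : ℝ) :
    (BFe0 ζ w s).det =
      ((w ^ 3 * (1 + s ^ 2) ^ 5 * (1 + 2 * s ^ 2) * (ζ + 3 * ζ * s ^ 2 + (1 + ζ) * s ^ 4) ^ 2 *
          (ζ + 3 * ζ * s ^ 2 - 2 * (1 - 2 * ζ) * s ^ 4) : ℝ) : ℂ) := by
  rw [← Matrix.det_reindex_self blockEquiv, BFe0_reindex, Nblocks, Matrix.det_fromBlocks_zero₂₁,
    Matrix.det_fromBlocks_zero₂₁, Matrix.det_fromBlocks_zero₂₁, det_H3, det_K2, det_K2', det_D5]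
  push_cast
  ring

/-- The real-valued determinant of the family (the closed form of `det_BFe0`). [cite: MagnenRivasseauSeneor1993, §VI (VI.9), (VI.14) pp.370–372] -/
def detBFe0 (ζ w s : ℝ) : ℝ :=
  w ^ 3 * (1 + s ^ 2) ^ 5 * (1 + 2 * s ^ 2) * (ζ + 3 * ζ * s ^ 2 + (1 + ζ) * s ^ 4) ^ 2 *
    (ζ + 3 * ζ * s ^ 2 - 2 * (1 - 2 * ζ) * s ^ 4)

/-- `det BF` on the family is the real number `detBFe0 ζ w s`. [cite: MagnenRivasseauSeneor1993, §VI (VI.9), (VI.14) pp.370–372] -/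
theorem det_BFe0_eq (ζ w s : ℝ) : (BFe0 ζ w s).det = ((detBFe0 ζ w s : ℝ) : ℂ) := by
  rw [det_BFe0, detBFe0]

/-- **Sign change at large background for every `ζ < 1/2`**: if `0 < ζ`, `0 < w` and `ζ(1 + 3s²) < 2(1 − 2ζ)s⁴` then `det BF < 0`.
[cite: MagnenRivasseauSeneor1993, §VI (VI.9), (VI.14), Lemma VI.2 pp.370–374] -/
theorem det_BFe0_neg {ζ w s : ℝ} (hζ : 0 < ζ) (hw : 0 < w) (hs : ζ * (1 + 3 * s ^ 2) < 2 * (1 - 2 * ζ) * s ^ 4) :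
    detBFe0 ζ w s < 0 := by
  unfold detBFe0
  have h1 : 0 < w ^ 3 * (1 + s ^ 2) ^ 5 * (1 + 2 * s ^ 2) * (ζ + 3 * ζ * s ^ 2 + (1 + ζ) * s ^ 4) ^ 2 := by
    have hq : 0 < ζ + 3 * ζ * s ^ 2 + (1 + ζ) * s ^ 4 := by positivity
    positivity
  have h2 : ζ + 3 * ζ * s ^ 2 - 2 * (1 - 2 * ζ) * s ^ 4 < 0 := by nlinarith
  exact mul_neg_of_pos_of_neg h1 h2

/-- … whereas for `ζ ≥ 1/2` (and `w > 0`, `ζ > 0`) the determinant stays positive on the whole family.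
[cite: MagnenRivasseauSeneor1993, §VI (VI.9), (VI.14) pp.370–372] -/
theorem det_BFe0_pos {ζ w : ℝ} (hζ : 1 / 2 ≤ ζ) (hw : 0 < w) (s : ℝ) : 0 < detBFe0 ζ w s := by
  unfold detBFe0
  have hζ0 : 0 < ζ := by linarith
  have hq : 0 < ζ + 3 * ζ * s ^ 2 + (1 + ζ) * s ^ 4 := by positivity
  have h2 : 0 < ζ + 3 * ζ * s ^ 2 - 2 * (1 - 2 * ζ) * s ^ 4 := by
    have : 0 ≤ (2 * ζ - 1) * s ^ 4 := mul_nonneg (by linarith) (by positivity)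
    nlinarith [sq_nonneg s]
  positivity

/-- **The homothetic value of record**: at `ζ = 3/13` (p.339), `w = ζ⁻¹ = 13/3`, `s = 2` (`β = 4`):
`det BF = −50311328125/3 < 0` — the exact-arithmetic value in the companion record §3(l), now a kernel theorem.
[cite: MagnenRivasseauSeneor1993, §VI (VI.9), (VI.14) pp.370–372; §II p.339 tl.34] -/
theorem det_BFe0_homothetic : (BFe0 (3 / 13) (13 / 3) 2).det = ((-50311328125 / 3 : ℝ) : ℂ) := by
  rw [det_BFe0_eq, detBFe0]
  norm_num

/-- … in particular it is negative there. [cite: MagnenRivasseauSeneor1993, §VI (VI.9), (VI.14) pp.370–372] -/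
theorem det_BFe0_homothetic_neg : detBFe0 (3 / 13) (13 / 3) 2 < 0 :=
  det_BFe0_neg (by norm_num) (by norm_num) (by norm_num)

/-- At `s = 0` (no background) `det BF = w³ζ³` (`= 1` for `w = ζ⁻¹`): the normalisation «at B(Δ) = 0 this quotient of determinants is
simply 1» (p.368 tl.4–5). [cite: MagnenRivasseauSeneor1993, §VI p.368, (VI.9) p.370] -/
theorem det_BFe0_zero (ζ w : ℝ) : detBFe0 ζ w 0 = w ^ 3 * ζ ^ 3 := by
  unfold detBFe0
  ring

/-- … so with `w = ζ⁻¹`, `ζ ≠ 0`: `det BF = 1` at zero background. [cite: MagnenRivasseauSeneor1993, §VI p.368, (VI.9) p.370] -/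
theorem det_BFe0_zero_inv {ζ : ℝ} (hζ : ζ ≠ 0) : detBFe0 ζ ζ⁻¹ 0 = 1 := by
  rw [det_BFe0_zero]
  field_simp


/-! ## §2 (v1.1) The same family for the CROSS-ordered operator: the determinant stays POSITIVE

With the `(1 − ζ)`-blocks transposed (`HomotheticA27.BFm1Cross`, the form p.357 tl.10 and (A.27) describe), the only change on the family
`p = (1,0,0,0)`, `κ = 1`, `x = y = s` is in the blocks `(1,2)`, `(2,1)` (`P₂P₁` for `P₁P₂`): the coupling `e_{1,2}–e_{2,1}` (paper's colours)
of the 3-block disappears and a coupling `e_{1,1}–e_{2,2}` appears instead. Block form `3 ⊕ 2 ⊕ 2 ⊕ 2 ⊕ 1³` and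
`det BF_cross = w³ ζ (1 + ζs²)(1 + (4 − ζ)s² + 2s⁴)(ζ + 3ζs² + (1 + ζ)s⁴)²((1 + s²)² − (1 − ζ)²s⁴)(1 + s²)²(1 + 2s²) > 0`
for all `s` whenever `0 < ζ ≤ 1`, `w > 0` (`det_BFe0Cross`, `det_BFe0Cross_pos`). -/

open HomotheticA27

/-- The cross-ordered 12 × 12 matrix: `1 + [BFm1Cross μ ν]`. [cite: MagnenRivasseauSeneor1993, §VI (VI.9) p.370; §IV p.357] -/
def BF12Cross (ζ w ψ x y n₀ n₁ n₂ n₃ : ℝ) : Matrix (Fin 4 × Fin 3) (Fin 4 × Fin 3) ℂ :=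
  Matrix.of fun i j => (if i = j then (1 : ℂ) else 0) + BFm1Cross ζ w ψ x y n₀ n₁ n₂ n₃ i.1 j.1 i.2 j.2

/-- The cross-ordered matrix on the family `p = (1,0,0,0)`, `ψ = κ = 1`, `x = y = s`. [cite: MagnenRivasseauSeneor1993, §VI (VI.9) p.370] -/
def BFe0Cross (ζ w s : ℝ) : Matrix (Fin 4 × Fin 3) (Fin 4 × Fin 3) ℂ := BF12Cross ζ w 1 s s 1 0 0 0

/-- Block index type for the cross case: `3 ⊕ 2 ⊕ 2 ⊕ (2 ⊕ 3)`. [cite: MagnenRivasseauSeneor1993, §VI (VI.9) p.370] -/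
abbrev BlockIdxC := (Fin 3 ⊕ Fin 2) ⊕ (Fin 2 ⊕ (Fin 2 ⊕ Fin 3))

/-- Coordinates → blocks (cross case): as `toBlock`, with `{(1,0),(2,1)}` now a 2-block and `{(3,0)},{(3,1)},{(3,2)}` the 1-blocks.
[cite: MagnenRivasseauSeneor1993, §VI (VI.9) p.370] -/
def toBlockC (i : Fin 4 × Fin 3) : BlockIdxC :=
  (![![Sum.inr (Sum.inl 0), Sum.inl (Sum.inr 0), Sum.inl (Sum.inl 0)],
     ![Sum.inr (Sum.inr (Sum.inl 0)), Sum.inl (Sum.inl 1), Sum.inl (Sum.inr 1)],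
     ![Sum.inl (Sum.inl 2), Sum.inr (Sum.inr (Sum.inl 1)), Sum.inr (Sum.inl 1)],
     ![Sum.inr (Sum.inr (Sum.inr 0)), Sum.inr (Sum.inr (Sum.inr 1)), Sum.inr (Sum.inr (Sum.inr 2))]] :
      Fin 4 → Fin 3 → BlockIdxC) i.1 i.2

/-- Blocks → coordinates (cross case). [cite: MagnenRivasseauSeneor1993, §VI (VI.9) p.370] -/
def fromBlockC : BlockIdxC → Fin 4 × Fin 3 :=
  Sum.elim (Sum.elim ![(0, 2), (1, 1), (2, 0)] ![(0, 1), (1, 2)])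
    (Sum.elim ![(0, 0), (2, 2)] (Sum.elim ![(1, 0), (2, 1)] ![(3, 0), (3, 1), (3, 2)]))

/-- The coordinate permutation (cross case). [cite: MagnenRivasseauSeneor1993, §VI (VI.9) p.370] -/
def blockEquivC : (Fin 4 × Fin 3) ≃ BlockIdxC where
  toFun := toBlockC
  invFun := fromBlockC
  left_inv := by
    intro i
    obtain ⟨μ, a⟩ := i
    fin_cases μ <;> fin_cases a <;> rfl
  right_inv := by
    intro k
    rcases k with ((k | k) | (k | (k | k))) <;> fin_cases k <;> rfl

/-- The 3-block of the cross case: `(w(ζ + 2s²), −i(1−ζ)s, i(1−ζ)s; i(1−ζ)ws, 1 + ζs², 0; −i(1−ζ)ws, 0, 1 + ζs²)` — the `(1−ζ)s²`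
coupling of `H3` is gone. [cite: MagnenRivasseauSeneor1993, §VI (VI.6), (VI.9) pp.369–370] -/
def H3C (ζ w s : ℝ) : Matrix (Fin 3) (Fin 3) ℂ :=
  !![(w * (ζ + 2 * s ^ 2) : ℝ), -(I * ((1 - ζ) * s : ℝ)), I * ((1 - ζ) * s : ℝ);
    I * ((1 - ζ) * w * s : ℝ), ((1 + ζ * s ^ 2 : ℝ) : ℂ), 0;
    -(I * ((1 - ζ) * w * s : ℝ)), 0, ((1 + ζ * s ^ 2 : ℝ) : ℂ)]

/-- The new 2-block of the cross case on `{e_{1,1}, e_{2,2}}` (paper's colours): `(1 + s², (1−ζ)s²; (1−ζ)s², 1 + s²)`.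
[cite: MagnenRivasseauSeneor1993, §VI (VI.6), (VI.9) pp.369–370] -/
def J2 (ζ s : ℝ) : Matrix (Fin 2) (Fin 2) ℂ :=
  !![((1 + s ^ 2 : ℝ) : ℂ), (((1 - ζ) * s ^ 2 : ℝ) : ℂ); (((1 - ζ) * s ^ 2 : ℝ) : ℂ), ((1 + s ^ 2 : ℝ) : ℂ)]

/-- The three decoupled `μ = 3` coordinates: `diag(1+s², 1+s², 1+2s²)`. [cite: MagnenRivasseauSeneor1993, §VI (VI.8), (VI.9) p.370] -/
def D3 (s : ℝ) : Matrix (Fin 3) (Fin 3) ℂ :=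
  Matrix.diagonal ![((1 + s ^ 2 : ℝ) : ℂ), ((1 + s ^ 2 : ℝ) : ℂ), ((1 + 2 * s ^ 2 : ℝ) : ℂ)]

/-- The block-diagonal normal form of the cross case. [cite: MagnenRivasseauSeneor1993, §VI (VI.9) p.370] -/
def NblocksC (ζ w s : ℝ) : Matrix BlockIdxC BlockIdxC ℂ :=
  Matrix.fromBlocks (Matrix.fromBlocks (H3C ζ w s) 0 0 (K2 ζ w s)) 0 0
    (Matrix.fromBlocks (K2' ζ w s) 0 0 (Matrix.fromBlocks (J2 ζ s) 0 0 (D3 s)))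

set_option maxHeartbeats 1600000 in
/-- **The cross-ordered `BF` on the family is block diagonal** (all 144 entries checked). [cite: MagnenRivasseauSeneor1993, §VI (VI.6), (VI.9) pp.369–370; §IV p.357] -/
theorem BFe0Cross_reindex (ζ w s : ℝ) : Matrix.reindex blockEquivC blockEquivC (BFe0Cross ζ w s) = NblocksC ζ w s := by
  ext k l
  rcases k with ((k | k) | (k | (k | k))) <;> rcases l with ((l | l) | (l | (l | l))) <;> fin_cases k <;> fin_cases l <;>
    simp [NblocksC, BFe0Cross, BF12Cross, BFm1Cross, blockEquivC, fromBlockC, H3C, K2, K2', J2, D3, PsqUnit, KFPUnit, Pmat,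
      nvec, Matrix.fromBlocks, Matrix.diagonal, Matrix.of_apply] <;>
    ring_nf <;> (try simp only [Complex.I_sq]) <;> (try ring_nf)

/-- `det H3C = wζ(1 + ζs²)(1 + (4 − ζ)s² + 2s⁴)`. [cite: MagnenRivasseauSeneor1993, §VI (VI.9) p.370] -/
theorem det_H3C (ζ w s : ℝ) :
    (H3C ζ w s).det = ((w * ζ * (1 + ζ * s ^ 2) * (1 + (4 - ζ) * s ^ 2 + 2 * s ^ 4) : ℝ) : ℂ) := by
  rw [H3C, Matrix.det_fin_three]
  simp
  ring_nf
  simp only [Complex.I_sq]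
  ring

/-- `det J2 = (1 + s²)² − (1 − ζ)²s⁴`. [cite: MagnenRivasseauSeneor1993, §VI (VI.9) p.370] -/
theorem det_J2 (ζ s : ℝ) : (J2 ζ s).det = (((1 + s ^ 2) ^ 2 - (1 - ζ) ^ 2 * s ^ 4 : ℝ) : ℂ) := by
  rw [J2, Matrix.det_fin_two]
  simp
  ring

/-- `det D3 = (1 + s²)²(1 + 2s²)`. [cite: MagnenRivasseauSeneor1993, §VI (VI.8) p.370] -/
theorem det_D3 (s : ℝ) : (D3 s).det = (((1 + s ^ 2) ^ 2 * (1 + 2 * s ^ 2) : ℝ) : ℂ) := by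
  rw [D3, Matrix.det_diagonal, Fin.prod_univ_three]
  simp only [Matrix.cons_val]
  push_cast
  ring

/-- The real closed form of the cross-case determinant. [cite: MagnenRivasseauSeneor1993, §VI (VI.9), (VI.14) pp.370–372; §IV p.357] -/
def detBFe0Cross (ζ w s : ℝ) : ℝ :=
  w ^ 3 * ζ * (1 + ζ * s ^ 2) * (1 + (4 - ζ) * s ^ 2 + 2 * s ^ 4) * (ζ + 3 * ζ * s ^ 2 + (1 + ζ) * s ^ 4) ^ 2 *
    ((1 + s ^ 2) ^ 2 - (1 - ζ) ^ 2 * s ^ 4) * ((1 + s ^ 2) ^ 2 * (1 + 2 * s ^ 2))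

/-- **The closed form, cross ordering.** [cite: MagnenRivasseauSeneor1993, §VI (VI.9), (VI.14) pp.370–372; §IV p.357; App. 1 (A.27) p.382] -/
theorem det_BFe0Cross (ζ w s : ℝ) : (BFe0Cross ζ w s).det = ((detBFe0Cross ζ w s : ℝ) : ℂ) := by
  rw [← Matrix.det_reindex_self blockEquivC, BFe0Cross_reindex, NblocksC, Matrix.det_fromBlocks_zero₂₁,
    Matrix.det_fromBlocks_zero₂₁, Matrix.det_fromBlocks_zero₂₁, Matrix.det_fromBlocks_zero₂₁, det_H3C, det_K2, det_K2', det_J2,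
    det_D3, detBFe0Cross]
  push_cast
  ring

/-- **For the cross ordering the determinant is POSITIVE on the whole family** (`0 < ζ ≤ 1`, `w > 0`, every `s`) — in line with (A.27)
holding for the cross form (`HomotheticA27.A27_crossForm_matrix`). [cite: MagnenRivasseauSeneor1993, §VI (VI.9), (VI.14) pp.370–372; App. 1 (A.27) p.382] -/
theorem det_BFe0Cross_pos {ζ w : ℝ} (hζ0 : 0 < ζ) (hζ1 : ζ ≤ 1) (hw : 0 < w) (s : ℝ) : 0 < detBFe0Cross ζ w s := by
  unfold detBFe0Cross
  have h1 : 0 < 1 + ζ * s ^ 2 := by positivity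
  have h2 : 0 < 1 + (4 - ζ) * s ^ 2 + 2 * s ^ 4 := by
    have : 0 ≤ (4 - ζ) * s ^ 2 := mul_nonneg (by linarith) (by positivity)
    positivity
  have h3 : 0 < ζ + 3 * ζ * s ^ 2 + (1 + ζ) * s ^ 4 := by positivity
  have h4 : 0 < (1 + s ^ 2) ^ 2 - (1 - ζ) ^ 2 * s ^ 4 := by
    have hζ' : 0 ≤ 1 - ζ := by linarith
    have ha : (1 - ζ) * s ^ 2 ≤ s ^ 2 := by nlinarith [sq_nonneg s]
    have hb : 0 ≤ (1 - ζ) * s ^ 2 := by positivity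
    nlinarith [sq_nonneg s]
  positivity

/-- At the homothetic point of record (`ζ = 3/13`, `w = 13/3`, `s = 2`) the cross-ordered determinant is positive (value
`89234619140625/28561`, the exact-arithmetic script's «det BF_Mt»), while the literal (VI.9) ordering gives `−50311328125/3`
(`det_BFe0_homothetic`). [cite: MagnenRivasseauSeneor1993, §VI (VI.9), (VI.14) pp.370–372] -/
theorem det_BFe0Cross_homothetic : (BFe0Cross (3 / 13) (13 / 3) 2).det = ((89234619140625 / 28561 : ℝ) : ℂ) := by
  rw [det_BFe0Cross, detBFe0Cross]
  norm_num

end DetSign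

end Literature.MathematicalPhysics.QuantumFieldTheory.MagnenRivasseauSeneor1993
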